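import Summits.RiemannHypothesis.RiemannHypothesis.Theorems.TiltedLandingLaw421R3BudgetBox

/-!
# K-2 budget, the cell cover — the RECTANGLE LEMMA and the EMPTY cell (C1 g36, W-08 ⟨33346⟩)

Support-level, claim-free plumbing under the perturbative box (`…R3BudgetBox`: `CellCover μ₀ →
GeometricBudget 10 μ₀`).  `CellAt μ₀ v z` asks for five cell constants `S₀ T₁ e₁ r₁ β₀` bounding the pair
geometry at `(v,z)`; this file produces them UNIFORMLY on a RECTANGLE of the pair's own normalised
coordinates `β = Im z/Im v ∈ [β₁,β₂]`, `δ = |Re z − Re v|/Im v ∈ [d₁,d₂]` from MONOTONE bounds (`S` is increasing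
in `β` and decreasing in `|δ|`, so `S ≥ S(β₁, d₂)`; the other currencies through the decoupled frame
`N₁ = δ²+(β−1)² ∈ [N₁ₗ,N₁ᵤ]`, `N₂ = δ²+(β+1)² ≥ N₂ₗ`, `N₁ ≥ 1/4` by separation):

* `cellAt_of_rect` — rectangle data + finitely many closed rational inequalities ⇒ `CellAt μ₀ v z`;
* `cellAt_of_empty` — a rectangle inside the separation disc `N₁ < 1/4` carries no pair.

(The tail cell `β ≥ β_T` and the bundled form `cellAt_of_rectData` used by the table are in `…R3BudgetRectTail`.)
So `CellCover μ₀` reduces to a FINITE TABLE of rectangles, each discharged by `norm_num`.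
Nothing here bears on the truth of RH; RH is not proved; `TiltedLandingLaw421R` and ⟨33346⟩/⟨33347⟩ OPEN.
-/

noncomputable section

open Complex
open scoped ComplexConjugate
open RhW08.UncoveredSign (pairPull)
open RhW08.PairSign (pairPull_eq leading_ge_three_of_touch)
open RhW08.BudgetAlgebra (pairExplicit re_im_pairExplicit_sub)
open RhW08.BudgetBox (CellOK CellAt CellCover)

namespace RhW08.BudgetRect

/-! ## §1 Coordinates `a = Im v`, `b = Im z`, `x = Re z − Re v`, `P = x²+(b−a)² = ‖z−v‖²`, `Q = x²+(b+a)² = ‖z−v̄‖²` -/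

/-- §1 the three squared norms in coordinates. -/
theorem coords (v z : ℂ) : ‖z - v‖ ^ 2 = (z.re - v.re) ^ 2 + (z.im - v.im) ^ 2 ∧
    Complex.normSq (z - v) = (z.re - v.re) ^ 2 + (z.im - v.im) ^ 2 ∧
    Complex.normSq (z - conj v) = (z.re - v.re) ^ 2 + (z.im + v.im) ^ 2 := by
  refine ⟨?_, ?_, ?_⟩
  · rw [← Complex.normSq_eq_norm_sq, Complex.normSq_apply]; simp only [sub_re, sub_im]; ring
  · rw [Complex.normSq_apply]; simp only [sub_re, sub_im]; ring
  · rw [Complex.normSq_apply]; simp only [sub_re, sub_im, conj_re, conj_im]; ring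

/-- §1 `T_z = 1 − 2·Im z·pairPull z v = 1 + 2b(b−a)/P + 2b(b+a)/Q`. -/
theorem tz_eq (v z : ℂ) : 1 - 2 * z.im * pairPull z v =
    1 + 2 * z.im * (z.im - v.im) / ((z.re - v.re) ^ 2 + (z.im - v.im) ^ 2)
      + 2 * z.im * (z.im + v.im) / ((z.re - v.re) ^ 2 + (z.im + v.im) ^ 2) := by
  rw [pairPull_eq]; ring

/-- §1 the zeroth-order slack `S = T_v + T_z − 3 = 2(b−a)²/P + 2(b+a)²/Q − 1` (cross identity). -/
theorem s_eq (v z : ℂ) : (1 - 2 * v.im * pairPull v z) + (1 - 2 * z.im * pairPull z v) - 3 =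
    2 * (z.im - v.im) ^ 2 / ((z.re - v.re) ^ 2 + (z.im - v.im) ^ 2)
      + 2 * (z.im + v.im) ^ 2 / ((z.re - v.re) ^ 2 + (z.im + v.im) ^ 2) - 1 := by
  rw [pairPull_eq, pairPull_eq]
  have e1 : (v.re - z.re) ^ 2 = (z.re - v.re) ^ 2 := by ring
  have e2 : (v.im - z.im) ^ 2 = (z.im - v.im) ^ 2 := by ring
  have e3 : (v.im + z.im) ^ 2 = (z.im + v.im) ^ 2 := by ring
  rw [e1, e2, e3]
  ring

/-- (real helper) monotonicity of a quotient: `0 ≤ n ≤ n'`, `0 < p' ≤ p` ⇒ `n/p ≤ n'/p'`. -/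
theorem div_mono {n n' p p' : ℝ} (hn : n ≤ n') (hn' : 0 ≤ n') (hp' : 0 < p') (hp : p' ≤ p) : n / p ≤ n' / p' :=
  (div_le_div_of_nonneg_right hn (hp'.le.trans hp)).trans (div_le_div_of_nonneg_left hn' hp' hp)

/-- (real helper) `t ↦ t/(X+t)` is increasing and `X ↦ t/(X+t)` decreasing: `0 ≤ s ≤ t`, `0 ≤ X ≤ D`, `0 < t` ⇒
`2s/(D+s) ≤ 2t/(X+t)` (also when `D + s = 0`, where the left side is `0`). -/
theorem sq_frac_mono {s t X D : ℝ} (hs : 0 ≤ s) (hst : s ≤ t) (hX : 0 ≤ X) (hXD : X ≤ D) (ht : 0 < t) :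
    2 * s / (D + s) ≤ 2 * t / (X + t) := by
  by_cases hDs : D + s = 0
  · rw [hDs, div_zero]; positivity
  · have hDs' : 0 < D + s := lt_of_le_of_ne (by linarith) (Ne.symm hDs)
    rw [div_le_div_iff₀ hDs' (by linarith)]
    nlinarith [mul_le_mul hst hXD hX ht.le]

/-! ## §2 The rectangle FRAME: `N₁ₗ a² ≤ P ≤ N₁ᵤ a²`, `N₂ₗ a² ≤ Q ≤ N₂ᵤ a²` -/

/-- §2 FRAME: on the rectangle `β₁ a ≤ b ≤ β₂ a`, `d₁ a ≤ |x| ≤ d₂ a` (`β₁ ≥ 1`, `d₁ ≥ 0`) of a separated pair,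
`N₁ₗ a² ≤ P ≤ N₁ᵤ a²` and `N₂ₗ a² ≤ Q ≤ N₂ᵤ a²` for any `N₁ₗ ≤ max(d₁²+(β₁−1)², 1/4)`, `N₁ᵤ ≥ d₂²+(β₂−1)²`,
`N₂ₗ ≤ d₁²+(β₁+1)²`, `N₂ᵤ ≥ d₂²+(β₂+1)²`; and `0 < P`, `0 < Q`. -/
theorem frame {v z : ℂ} {β₁ β₂ d₁ d₂ N₁ₗ N₁ᵤ N₂ₗ N₂ᵤ : ℝ}
    (hv : 0 < v.im) (hvz : v.im < z.im) (hsep : v.im ≤ 2 * ‖v - z‖)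
    (hβ1 : 1 ≤ β₁) (hb1 : β₁ * v.im ≤ z.im) (hb2 : z.im ≤ β₂ * v.im)
    (hd1 : 0 ≤ d₁) (hdl : d₁ * v.im ≤ |z.re - v.re|) (hdu : |z.re - v.re| ≤ d₂ * v.im)
    (hN1l : N₁ₗ ≤ max (d₁ ^ 2 + (β₁ - 1) ^ 2) (1 / 4)) (hN1u : d₂ ^ 2 + (β₂ - 1) ^ 2 ≤ N₁ᵤ)
    (hN2l : N₂ₗ ≤ d₁ ^ 2 + (β₁ + 1) ^ 2) (hN2u : d₂ ^ 2 + (β₂ + 1) ^ 2 ≤ N₂ᵤ) :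
    N₁ₗ * v.im ^ 2 ≤ (z.re - v.re) ^ 2 + (z.im - v.im) ^ 2 ∧
      (z.re - v.re) ^ 2 + (z.im - v.im) ^ 2 ≤ N₁ᵤ * v.im ^ 2 ∧
      N₂ₗ * v.im ^ 2 ≤ (z.re - v.re) ^ 2 + (z.im + v.im) ^ 2 ∧
      (z.re - v.re) ^ 2 + (z.im + v.im) ^ 2 ≤ N₂ᵤ * v.im ^ 2 ∧
      0 < (z.re - v.re) ^ 2 + (z.im - v.im) ^ 2 ∧ 0 < (z.re - v.re) ^ 2 + (z.im + v.im) ^ 2 := by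
  obtain ⟨hn, -, -⟩ := coords v z
  set a := v.im with ha
  set b := z.im with hb
  set x := z.re - v.re with hx
  have hx2u : x ^ 2 ≤ (d₂ * a) ^ 2 := by
    calc x ^ 2 = |x| ^ 2 := (sq_abs x).symm
      _ ≤ (d₂ * a) ^ 2 := pow_le_pow_left₀ (abs_nonneg x) hdu 2
  have hx2l : (d₁ * a) ^ 2 ≤ x ^ 2 := by
    calc (d₁ * a) ^ 2 ≤ |x| ^ 2 := pow_le_pow_left₀ (by positivity) hdl 2
      _ = x ^ 2 := sq_abs x
  have e1 : (β₁ - 1) * a = β₁ * a - a := by ring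
  have e2 : (β₂ - 1) * a = β₂ * a - a := by ring
  have e3 : (β₁ + 1) * a = β₁ * a + a := by ring
  have e4 : (β₂ + 1) * a = β₂ * a + a := by ring
  have hbal : (β₁ - 1) * a ≤ b - a := by rw [e1]; linarith
  have hbau : b - a ≤ (β₂ - 1) * a := by rw [e2]; linarith
  have hbpl : (β₁ + 1) * a ≤ b + a := by rw [e3]; linarith
  have hbpu : b + a ≤ (β₂ + 1) * a := by rw [e4]; linarith
  have h0 : 0 ≤ (β₁ - 1) * a := mul_nonneg (by linarith) hv.le
  have h0' : 0 ≤ (β₁ + 1) * a := mul_nonneg (by linarith) hv.le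
  have h1 : ((β₁ - 1) * a) ^ 2 ≤ (b - a) ^ 2 := pow_le_pow_left₀ h0 hbal 2
  have h2 : (b - a) ^ 2 ≤ ((β₂ - 1) * a) ^ 2 := pow_le_pow_left₀ (by linarith) hbau 2
  have h3 : ((β₁ + 1) * a) ^ 2 ≤ (b + a) ^ 2 := pow_le_pow_left₀ h0' hbpl 2
  have h4 : (b + a) ^ 2 ≤ ((β₂ + 1) * a) ^ 2 := pow_le_pow_left₀ (by linarith) hbpu 2
  have hba0 : 0 < b - a := by linarith
  have hbp0 : 0 < b + a := by linarith
  have hP0 : 0 < x ^ 2 + (b - a) ^ 2 := by positivity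
  have hQ0 : 0 < x ^ 2 + (b + a) ^ 2 := by positivity
  refine ⟨?_, ?_, ?_, ?_, hP0, hQ0⟩
  · rcases le_max_iff.mp hN1l with h | h
    · calc N₁ₗ * a ^ 2 ≤ (d₁ ^ 2 + (β₁ - 1) ^ 2) * a ^ 2 := mul_le_mul_of_nonneg_right h (sq_nonneg a)
        _ = (d₁ * a) ^ 2 + ((β₁ - 1) * a) ^ 2 := by ring
        _ ≤ x ^ 2 + (b - a) ^ 2 := by linarith
    · have hs : a ^ 2 ≤ (2 * ‖v - z‖) ^ 2 := pow_le_pow_left₀ hv.le hsep 2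
      have hn' : ‖v - z‖ ^ 2 = x ^ 2 + (b - a) ^ 2 := by rw [norm_sub_rev]; exact hn
      calc N₁ₗ * a ^ 2 ≤ (1 / 4) * a ^ 2 := mul_le_mul_of_nonneg_right h (sq_nonneg a)
        _ ≤ x ^ 2 + (b - a) ^ 2 := by nlinarith
  · calc x ^ 2 + (b - a) ^ 2 ≤ (d₂ * a) ^ 2 + ((β₂ - 1) * a) ^ 2 := by linarith
      _ = (d₂ ^ 2 + (β₂ - 1) ^ 2) * a ^ 2 := by ring
      _ ≤ N₁ᵤ * a ^ 2 := mul_le_mul_of_nonneg_right hN1u (sq_nonneg a)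
  · calc N₂ₗ * a ^ 2 ≤ (d₁ ^ 2 + (β₁ + 1) ^ 2) * a ^ 2 := mul_le_mul_of_nonneg_right hN2l (sq_nonneg a)
      _ = (d₁ * a) ^ 2 + ((β₁ + 1) * a) ^ 2 := by ring
      _ ≤ x ^ 2 + (b + a) ^ 2 := by linarith
  · calc x ^ 2 + (b + a) ^ 2 ≤ (d₂ * a) ^ 2 + ((β₂ + 1) * a) ^ 2 := by linarith
      _ = (d₂ ^ 2 + (β₂ + 1) ^ 2) * a ^ 2 := by ring
      _ ≤ N₂ᵤ * a ^ 2 := mul_le_mul_of_nonneg_right hN2u (sq_nonneg a)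

/-! ## §3 The four clauses on a rectangle -/

/-- §3(S) `S = 2(b−a)²/P + 2(b+a)²/Q − 1` is increasing in `β` and decreasing in `|δ|`:
`S₀ ≤ max(0, 2(β₁−1)²/(d₂²+(β₁−1)²) + 2(β₁+1)²/(d₂²+(β₁+1)²) − 1)` ⇒ `S₀ ≤ T_v + T_z − 3` (touching pair). -/
theorem s_ge {v z : ℂ} {β₁ d₂ S₀ : ℝ}
    (hv : 0 < v.im) (hvz : v.im < z.im) (ht : |v.re - z.re| ≤ v.im + z.im)
    (hβ1 : 1 ≤ β₁) (hb1 : β₁ * v.im ≤ z.im) (hdu : |z.re - v.re| ≤ d₂ * v.im)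
    (hS : S₀ ≤ max 0 (2 * (β₁ - 1) ^ 2 / (d₂ ^ 2 + (β₁ - 1) ^ 2) + 2 * (β₁ + 1) ^ 2 / (d₂ ^ 2 + (β₁ + 1) ^ 2) - 1)) :
    S₀ ≤ (1 - 2 * v.im * pairPull v z) + (1 - 2 * z.im * pairPull z v) - 3 := by
  rcases le_max_iff.mp hS with h | h
  · have h3 := leading_ge_three_of_touch (v := v) (z := z) (by linarith) ht
    linarith
  · rw [s_eq]
    set a := v.im with ha
    set b := z.im with hb
    set x := z.re - v.re with hx
    have ha0 : a ≠ 0 := hv.ne'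
    have hx2u : x ^ 2 ≤ (d₂ * a) ^ 2 := by
      calc x ^ 2 = |x| ^ 2 := (sq_abs x).symm
        _ ≤ (d₂ * a) ^ 2 := pow_le_pow_left₀ (abs_nonneg x) hdu 2
    have e1 : (β₁ - 1) * a = β₁ * a - a := by ring
    have e3 : (β₁ + 1) * a = β₁ * a + a := by ring
    have hbal : (β₁ - 1) * a ≤ b - a := by rw [e1]; linarith
    have hbpl : (β₁ + 1) * a ≤ b + a := by rw [e3]; linarith
    have h0 : 0 ≤ (β₁ - 1) * a := mul_nonneg (by linarith) hv.le
    have h0' : 0 ≤ (β₁ + 1) * a := mul_nonneg (by linarith) hv.le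
    have h1 : ((β₁ - 1) * a) ^ 2 ≤ (b - a) ^ 2 := pow_le_pow_left₀ h0 hbal 2
    have h3 : ((β₁ + 1) * a) ^ 2 ≤ (b + a) ^ 2 := pow_le_pow_left₀ h0' hbpl 2
    have hba0 : 0 < b - a := by linarith
    have hbp0 : 0 < b + a := by linarith
    have f1 : 2 * (β₁ - 1) ^ 2 / (d₂ ^ 2 + (β₁ - 1) ^ 2) =
        2 * ((β₁ - 1) * a) ^ 2 / ((d₂ * a) ^ 2 + ((β₁ - 1) * a) ^ 2) := by
      rw [show 2 * ((β₁ - 1) * a) ^ 2 = 2 * (β₁ - 1) ^ 2 * a ^ 2 by ring,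
        show (d₂ * a) ^ 2 + ((β₁ - 1) * a) ^ 2 = (d₂ ^ 2 + (β₁ - 1) ^ 2) * a ^ 2 by ring,
        mul_div_mul_right _ _ (pow_ne_zero 2 ha0)]
    have f2 : 2 * (β₁ + 1) ^ 2 / (d₂ ^ 2 + (β₁ + 1) ^ 2) =
        2 * ((β₁ + 1) * a) ^ 2 / ((d₂ * a) ^ 2 + ((β₁ + 1) * a) ^ 2) := by
      rw [show 2 * ((β₁ + 1) * a) ^ 2 = 2 * (β₁ + 1) ^ 2 * a ^ 2 by ring,
        show (d₂ * a) ^ 2 + ((β₁ + 1) * a) ^ 2 = (d₂ ^ 2 + (β₁ + 1) ^ 2) * a ^ 2 by ring,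
        mul_div_mul_right _ _ (pow_ne_zero 2 ha0)]
    have g1 : 2 * ((β₁ - 1) * a) ^ 2 / ((d₂ * a) ^ 2 + ((β₁ - 1) * a) ^ 2) ≤
        2 * (b - a) ^ 2 / (x ^ 2 + (b - a) ^ 2) :=
      sq_frac_mono (sq_nonneg _) h1 (sq_nonneg x) hx2u (pow_pos hba0 2)
    have g2 : 2 * ((β₁ + 1) * a) ^ 2 / ((d₂ * a) ^ 2 + ((β₁ + 1) * a) ^ 2) ≤
        2 * (b + a) ^ 2 / (x ^ 2 + (b + a) ^ 2) :=
      sq_frac_mono (sq_nonneg _) h3 (sq_nonneg x) hx2u (pow_pos hbp0 2)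
    rw [f1, f2] at h
    linarith

/-- §3(T) frame `N₁ₗa² ≤ P`, `N₂ₗa² ≤ Q` (`N₁ₗ, N₂ₗ > 0`), `b ≤ β₂ a` ⇒ `T_z ≤ 1 + 2β₂(β₂−1)/N₁ₗ + 2β₂(β₂+1)/N₂ₗ`. -/
theorem tz_le {v z : ℂ} {β₂ N₁ₗ N₂ₗ T₁ : ℝ}
    (hv : 0 < v.im) (hvz : v.im < z.im) (hb2 : z.im ≤ β₂ * v.im)
    (hN1l0 : 0 < N₁ₗ) (hN2l0 : 0 < N₂ₗ)
    (hPl : N₁ₗ * v.im ^ 2 ≤ (z.re - v.re) ^ 2 + (z.im - v.im) ^ 2)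
    (hQl : N₂ₗ * v.im ^ 2 ≤ (z.re - v.re) ^ 2 + (z.im + v.im) ^ 2)
    (hT : 1 + 2 * β₂ * (β₂ - 1) / N₁ₗ + 2 * β₂ * (β₂ + 1) / N₂ₗ ≤ T₁) :
    1 - 2 * z.im * pairPull z v ≤ T₁ := by
  rw [tz_eq]
  set a := v.im with ha
  set b := z.im with hb
  set x := z.re - v.re with hx
  have ha0 : a ≠ 0 := hv.ne'
  have e2 : (β₂ - 1) * a = β₂ * a - a := by ring
  have e4 : (β₂ + 1) * a = β₂ * a + a := by ring
  have hbau : b - a ≤ (β₂ - 1) * a := by rw [e2]; linarith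
  have hbpu : b + a ≤ (β₂ + 1) * a := by rw [e4]; linarith
  have hb0 : 0 ≤ b := by linarith
  have n1 : 2 * b * (b - a) ≤ 2 * (β₂ * a) * ((β₂ - 1) * a) := by
    have := mul_le_mul hb2 hbau (by linarith) (hb0.trans hb2)
    linarith
  have n2 : 2 * b * (b + a) ≤ 2 * (β₂ * a) * ((β₂ + 1) * a) := by
    have := mul_le_mul hb2 hbpu (by linarith) (hb0.trans hb2)
    linarith
  have f1 : 2 * β₂ * (β₂ - 1) / N₁ₗ = 2 * (β₂ * a) * ((β₂ - 1) * a) / (N₁ₗ * a ^ 2) := by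
    field_simp
  have f2 : 2 * β₂ * (β₂ + 1) / N₂ₗ = 2 * (β₂ * a) * ((β₂ + 1) * a) / (N₂ₗ * a ^ 2) := by
    field_simp
  have hba0 : 0 ≤ b - a := by linarith
  have hbp0 : 0 ≤ b + a := by linarith
  have p1 : 0 ≤ 2 * (β₂ * a) * ((β₂ - 1) * a) :=
    le_trans (mul_nonneg (mul_nonneg two_pos.le hb0) hba0) n1
  have p2 : 0 ≤ 2 * (β₂ * a) * ((β₂ + 1) * a) :=
    le_trans (mul_nonneg (mul_nonneg two_pos.le hb0) hbp0) n2
  have g1 : 2 * b * (b - a) / (x ^ 2 + (b - a) ^ 2) ≤ 2 * (β₂ * a) * ((β₂ - 1) * a) / (N₁ₗ * a ^ 2) :=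
    div_mono n1 p1 (by positivity) hPl
  have g2 : 2 * b * (b + a) / (x ^ 2 + (b + a) ^ 2) ≤ 2 * (β₂ * a) * ((β₂ + 1) * a) / (N₂ₗ * a ^ 2) :=
    div_mono n2 p2 (by positivity) hQl
  rw [f1, f2] at hT
  linarith

/-- §3(E) the explicit difference on a rectangle: `Im v·‖E_z − E_v‖ ≤ e₁` whenever
`2d₂/N₁ₗ + 2d₂/N₂ₗ ≤ R₁`, `1/2 − 1/(2β₂) − 2(β₁−1)/N₁ᵤ ≤ I₁`, `−I₁ ≤ 1/2 − 1/(2β₁) − 2(β₂−1)/N₁ₗ`, `R₁²+I₁² ≤ e₁²`, `e₁ ≥ 0`. -/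
theorem e_le {v z : ℂ} {β₁ β₂ d₂ N₁ₗ N₁ᵤ N₂ₗ R₁ I₁ e₁ : ℝ}
    (hv : 0 < v.im) (hvz : v.im < z.im)
    (hβ1 : 1 ≤ β₁) (hb1 : β₁ * v.im ≤ z.im) (hb2 : z.im ≤ β₂ * v.im) (hdu : |z.re - v.re| ≤ d₂ * v.im)
    (hN1l0 : 0 < N₁ₗ) (hN2l0 : 0 < N₂ₗ)
    (hPl : N₁ₗ * v.im ^ 2 ≤ (z.re - v.re) ^ 2 + (z.im - v.im) ^ 2)
    (hPu : (z.re - v.re) ^ 2 + (z.im - v.im) ^ 2 ≤ N₁ᵤ * v.im ^ 2)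
    (hQl : N₂ₗ * v.im ^ 2 ≤ (z.re - v.re) ^ 2 + (z.im + v.im) ^ 2)
    (hP0 : 0 < (z.re - v.re) ^ 2 + (z.im - v.im) ^ 2)
    (hR : 2 * d₂ / N₁ₗ + 2 * d₂ / N₂ₗ ≤ R₁)
    (hIu : 1 / 2 - 1 / (2 * β₂) - 2 * (β₁ - 1) / N₁ᵤ ≤ I₁)
    (hIl : -I₁ ≤ 1 / 2 - 1 / (2 * β₁) - 2 * (β₂ - 1) / N₁ₗ)
    (he0 : 0 ≤ e₁) (he : R₁ ^ 2 + I₁ ^ 2 ≤ e₁ ^ 2) :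
    v.im * ‖pairExplicit z v - pairExplicit v z‖ ≤ e₁ := by
  have hb : 0 < z.im := hv.trans hvz
  have hne : v ≠ z := fun h => by rw [h] at hvz; exact lt_irrefl _ hvz
  obtain ⟨hre, him⟩ := re_im_pairExplicit_sub hv hb hne
  obtain ⟨-, hN1, hN2⟩ := coords v z
  rw [hN1, hN2] at hre
  rw [hN1] at him
  set E := pairExplicit z v - pairExplicit v z with hE
  set a := v.im with ha
  set b := z.im with hb'
  set x := z.re - v.re with hx
  have ha0 : a ≠ 0 := hv.ne'
  have hbp0 : 0 < b + a := by linarith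
  have hQ0 : 0 < x ^ 2 + (b + a) ^ 2 := by positivity
  have hd2 : 0 ≤ d₂ := le_of_mul_le_mul_right (by simpa using (abs_nonneg x).trans hdu) hv
  -- the real part: `a·Re E = (2a/P + 2a/Q)·x`, `|x| ≤ d₂ a`
  have hxu : x ≤ d₂ * a := (le_abs_self x).trans hdu
  have hxl : -(d₂ * a) ≤ x := by have := neg_abs_le x; linarith [hdu]
  have hc0 : 0 ≤ 2 * a / (x ^ 2 + (b - a) ^ 2) + 2 * a / (x ^ 2 + (b + a) ^ 2) := by positivity
  have hre' : a * E.re = (2 * a / (x ^ 2 + (b - a) ^ 2) + 2 * a / (x ^ 2 + (b + a) ^ 2)) * x := by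
    rw [hre]; ring
  have hcap : (2 * a / (x ^ 2 + (b - a) ^ 2) + 2 * a / (x ^ 2 + (b + a) ^ 2)) * (d₂ * a) ≤ R₁ := by
    have f1 : 2 * d₂ / N₁ₗ = 2 * a * (d₂ * a) / (N₁ₗ * a ^ 2) := by field_simp
    have f2 : 2 * d₂ / N₂ₗ = 2 * a * (d₂ * a) / (N₂ₗ * a ^ 2) := by field_simp
    have p0 : 0 ≤ 2 * a * (d₂ * a) := by positivity
    have g1 : 2 * a * (d₂ * a) / (x ^ 2 + (b - a) ^ 2) ≤ 2 * a * (d₂ * a) / (N₁ₗ * a ^ 2) :=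
      div_le_div_of_nonneg_left p0 (by positivity) hPl
    have g2 : 2 * a * (d₂ * a) / (x ^ 2 + (b + a) ^ 2) ≤ 2 * a * (d₂ * a) / (N₂ₗ * a ^ 2) :=
      div_le_div_of_nonneg_left p0 (by positivity) hQl
    have e : (2 * a / (x ^ 2 + (b - a) ^ 2) + 2 * a / (x ^ 2 + (b + a) ^ 2)) * (d₂ * a) =
        2 * a * (d₂ * a) / (x ^ 2 + (b - a) ^ 2) + 2 * a * (d₂ * a) / (x ^ 2 + (b + a) ^ 2) := by ring
    rw [f1, f2] at hR
    linarith
  have hReu : a * E.re ≤ R₁ := by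
    rw [hre']; exact (mul_le_mul_of_nonneg_left hxu hc0).trans hcap
  have hRel : -R₁ ≤ a * E.re := by
    rw [hre']
    have := mul_le_mul_of_nonneg_left hxl hc0
    linarith
  -- the imaginary part: `a·Im E = 1/2 − a/(2b) − 2a(b−a)/P`
  have him' : a * E.im = 1 / 2 - a / (2 * b) - 2 * a * (b - a) / (x ^ 2 + (b - a) ^ 2) := by
    rw [him]; field_simp
  have hβ2 : 1 < β₂ := lt_of_mul_lt_mul_right (by linarith : 1 * a < β₂ * a) hv.le
  have hba0 : 0 < b - a := by linarith
  have q1 : 1 / (2 * β₂) ≤ a / (2 * b) := by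
    rw [div_le_div_iff₀ (by linarith) (by linarith)]; linarith
  have q2 : a / (2 * b) ≤ 1 / (2 * β₁) := by
    rw [div_le_div_iff₀ (by linarith) (by linarith)]; linarith
  have e1 : (β₁ - 1) * a = β₁ * a - a := by ring
  have e2 : (β₂ - 1) * a = β₂ * a - a := by ring
  have hbal : (β₁ - 1) * a ≤ b - a := by rw [e1]; linarith
  have hbau : b - a ≤ (β₂ - 1) * a := by rw [e2]; linarith
  have hN1u0 : 0 < N₁ᵤ * a ^ 2 := lt_of_lt_of_le hP0 hPu
  have hN1u' : N₁ᵤ ≠ 0 := by intro h0n; rw [h0n, zero_mul] at hN1u0; exact lt_irrefl _ hN1u0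
  have q3 : 2 * (β₁ - 1) / N₁ᵤ ≤ 2 * a * (b - a) / (x ^ 2 + (b - a) ^ 2) := by
    have f : 2 * (β₁ - 1) / N₁ᵤ = 2 * a * ((β₁ - 1) * a) / (N₁ᵤ * a ^ 2) := by field_simp
    rw [f]
    exact div_mono (mul_le_mul_of_nonneg_left hbal (by positivity)) (mul_nonneg (by positivity) hba0.le) hP0 hPu
  have q4 : 2 * a * (b - a) / (x ^ 2 + (b - a) ^ 2) ≤ 2 * (β₂ - 1) / N₁ₗ := by
    have f : 2 * (β₂ - 1) / N₁ₗ = 2 * a * ((β₂ - 1) * a) / (N₁ₗ * a ^ 2) := by field_simp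
    rw [f]
    exact div_mono (mul_le_mul_of_nonneg_left hbau (by positivity))
      (mul_nonneg (by positivity) (mul_nonneg (by linarith) hv.le)) (by positivity) hPl
  have hImu : a * E.im ≤ I₁ := by rw [him']; linarith
  have hIml : -I₁ ≤ a * E.im := by rw [him']; linarith
  -- squares and the norm
  have s1 : (a * E.re) ^ 2 ≤ R₁ ^ 2 := sq_le_sq' hRel hReu
  have s2 : (a * E.im) ^ 2 ≤ I₁ ^ 2 := sq_le_sq' hIml hImu
  have hn : (a * ‖E‖) ^ 2 = (a * E.re) ^ 2 + (a * E.im) ^ 2 := by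
    rw [mul_pow, ← Complex.normSq_eq_norm_sq, Complex.normSq_apply]; ring
  have hsq : (a * ‖E‖) ^ 2 ≤ e₁ ^ 2 := by rw [hn]; linarith
  exact (pow_le_pow_iff_left₀ (by positivity) he0 two_ne_zero).mp hsq

/-- §3(r) frame `P ≤ N₁ᵤ a²`, `N₁ᵤ ≤ (r₁β₁)²`, `β₁ a ≤ b`, `r₁ ≥ 0` ⇒ `‖z − v‖ ≤ r₁·Im z`. -/
theorem r_le {v z : ℂ} {β₁ N₁ᵤ r₁ : ℝ}
    (hv : 0 < v.im) (hβ1 : 1 ≤ β₁) (hb1 : β₁ * v.im ≤ z.im)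
    (hPu : (z.re - v.re) ^ 2 + (z.im - v.im) ^ 2 ≤ N₁ᵤ * v.im ^ 2)
    (hr0 : 0 ≤ r₁) (hr : N₁ᵤ ≤ (r₁ * β₁) ^ 2) : ‖z - v‖ ≤ r₁ * z.im := by
  obtain ⟨hn, -, -⟩ := coords v z
  have h1 : ‖z - v‖ ^ 2 ≤ (r₁ * (β₁ * v.im)) ^ 2 := by
    rw [hn]
    calc (z.re - v.re) ^ 2 + (z.im - v.im) ^ 2 ≤ N₁ᵤ * v.im ^ 2 := hPu
      _ ≤ (r₁ * β₁) ^ 2 * v.im ^ 2 := mul_le_mul_of_nonneg_right hr (sq_nonneg _)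
      _ = (r₁ * (β₁ * v.im)) ^ 2 := by ring
  have h2 : r₁ * (β₁ * v.im) ≤ r₁ * z.im := mul_le_mul_of_nonneg_left hb1 hr0
  have h3 : 0 ≤ r₁ * (β₁ * v.im) := by
    have : 0 ≤ β₁ * v.im := mul_nonneg (by linarith) hv.le
    positivity
  have h4 := (pow_le_pow_iff_left₀ (norm_nonneg _) h3 two_ne_zero).mp h1
  exact h4.trans h2

/-! ## §4 The rectangle lemma and the empty cell -/

/-- ★ §4 THE RECTANGLE LEMMA: a separated touching pair whose normalised coordinates lie in the rectangle
`β₁·Im v ≤ Im z ≤ β₂·Im v`, `d₁·Im v ≤ |Re z − Re v| ≤ d₂·Im v` (`β₁ ≥ 1`, `d₁ ≥ 0`), together with cell data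
`N₁ₗ N₁ᵤ N₂ₗ S₀ T₁ R₁ I₁ e₁ r₁` satisfying finitely many closed inequalities (all decidable by `norm_num`
on rational data), satisfies `CellAt μ₀ v z` with the constants `S₀, T₁, e₁, r₁, β₀ := β₁`. -/
theorem cellAt_of_rect {v z : ℂ} {μ₀ β₁ β₂ d₁ d₂ N₁ₗ N₁ᵤ N₂ₗ S₀ T₁ R₁ I₁ e₁ r₁ : ℝ}
    (hv : 0 < v.im) (hvz : v.im < z.im) (ht : |v.re - z.re| ≤ v.im + z.im) (hsep : v.im ≤ 2 * ‖v - z‖)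
    (hβ1 : 1 ≤ β₁) (hb1 : β₁ * v.im ≤ z.im) (hb2 : z.im ≤ β₂ * v.im)
    (hd1 : 0 ≤ d₁) (hdl : d₁ * v.im ≤ |z.re - v.re|) (hdu : |z.re - v.re| ≤ d₂ * v.im)
    (hN1l : N₁ₗ ≤ max (d₁ ^ 2 + (β₁ - 1) ^ 2) (1 / 4)) (hN1l0 : 0 < N₁ₗ)
    (hN1u : d₂ ^ 2 + (β₂ - 1) ^ 2 ≤ N₁ᵤ)
    (hN2l : N₂ₗ ≤ d₁ ^ 2 + (β₁ + 1) ^ 2) (hN2l0 : 0 < N₂ₗ) (hS0 : 0 ≤ S₀)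
    (hS : S₀ ≤ max 0 (2 * (β₁ - 1) ^ 2 / (d₂ ^ 2 + (β₁ - 1) ^ 2) + 2 * (β₁ + 1) ^ 2 / (d₂ ^ 2 + (β₁ + 1) ^ 2) - 1))
    (hT : 1 + 2 * β₂ * (β₂ - 1) / N₁ₗ + 2 * β₂ * (β₂ + 1) / N₂ₗ ≤ T₁) (hT10 : T₁ ≤ 10)
    (hR : 2 * d₂ / N₁ₗ + 2 * d₂ / N₂ₗ ≤ R₁)
    (hIu : 1 / 2 - 1 / (2 * β₂) - 2 * (β₁ - 1) / N₁ᵤ ≤ I₁)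
    (hIl : -I₁ ≤ 1 / 2 - 1 / (2 * β₁) - 2 * (β₂ - 1) / N₁ₗ)
    (he0 : 0 ≤ e₁) (he : R₁ ^ 2 + I₁ ^ 2 ≤ e₁ ^ 2) (hr0 : 0 ≤ r₁) (hr : N₁ᵤ ≤ (r₁ * β₁) ^ 2)
    (hPlo : 2 / 3 ≤ e₁ + μ₀ * r₁) (hPhi : e₁ + μ₀ * r₁ ≤ 13 / 2)
    (hOK : CellOK S₀ T₁ (e₁ + μ₀ * r₁) β₁ μ₀) : CellAt μ₀ v z := by
  obtain ⟨hPl, hPu, hQl, -, hP0, hQ0⟩ :=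
    frame (N₂ᵤ := d₂ ^ 2 + (β₂ + 1) ^ 2) hv hvz hsep hβ1 hb1 hb2 hd1 hdl hdu hN1l hN1u hN2l le_rfl
  exact ⟨S₀, T₁, e₁, r₁, β₁, hS0, s_ge hv hvz ht hβ1 hb1 hdu hS,
    tz_le hv hvz hb2 hN1l0 hN2l0 hPl hQl hT, hT10,
    e_le hv hvz hβ1 hb1 hb2 hdu hN1l0 hN2l0 hPl hPu hQl hP0 hR hIu hIl he0 he,
    r_le hv hβ1 hb1 hPu hr0 hr, hβ1, hb1, hPlo, hPhi, hOK⟩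

/-- §4 THE EMPTY CELL: a rectangle with `d₂² + (β₂−1)² < 1/4` lies inside the separation disc
`‖z − v‖ < Im v/2`, so it carries no separated pair and `CellAt` holds vacuously. -/
theorem cellAt_of_empty {v z : ℂ} {μ₀ β₁ β₂ d₂ : ℝ}
    (hv : 0 < v.im) (hvz : v.im < z.im) (hsep : v.im ≤ 2 * ‖v - z‖)
    (hβ1 : 1 ≤ β₁) (hb1 : β₁ * v.im ≤ z.im) (hb2 : z.im ≤ β₂ * v.im) (hdu : |z.re - v.re| ≤ d₂ * v.im)
    (hN : d₂ ^ 2 + (β₂ - 1) ^ 2 < 1 / 4) : CellAt μ₀ v z := by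
  exfalso
  obtain ⟨hPl, hPu, -⟩ := frame (d₁ := 0) (N₁ₗ := 1 / 4) (N₁ᵤ := d₂ ^ 2 + (β₂ - 1) ^ 2) (N₂ₗ := 0)
    (N₂ᵤ := d₂ ^ 2 + (β₂ + 1) ^ 2) hv hvz hsep hβ1 hb1 hb2 le_rfl
    (by rw [zero_mul]; exact abs_nonneg _) hdu (le_max_right _ _) le_rfl (by positivity) le_rfl
  have h := mul_lt_mul_of_pos_right hN (pow_pos hv 2)
  linarith

end RhW08.BudgetRect
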